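import Mathlib
import HarnessLib

/-!
# Laplace transforms of convolutions of measures on the half-line

Topic `Literature/Analysis/Convolution`. Everything in this file is PROVED (no named facts, no
definitions).

For (positive, Borel) measures `μ, ν` on `ℝ` Mathlib's additive convolution
`μ ∗ ν = (μ.prod ν).map (+)` (`MeasureTheory.Measure.conv`, file
`Mathlib/MeasureTheory/Group/Convolution.lean`) is the distribution of the sum of two independent
variables, and the Laplace transform turns it into a product:

  `∫ e^{-lt} d(μ ∗ ν)(l) = (∫ e^{-lt} dμ(l)) · (∫ e^{-lt} dν(l))`

(`integral_exp_neg_mul_conv`, the "product theorem" for Laplace–Stieltjes transforms, Widder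
Ch. II, Thm 11.5; Feller XIII.2 (2.2)). Since the integrand is positive, with Mathlib's
conventions (`∫` of a non-integrable function is `0`, `(∞).toReal = 0`) the identity holds for
ALL measures (`ν` s-finite) and all real `t`, with no support or finiteness hypothesis; the
proof is three lines of `lintegral` algebra (`MeasureTheory.Measure.lintegral_conv`).

Supports and charged intervals behave as expected: if `μ` lives on `[a, ∞)` and `ν` on `[b, ∞)`
then `μ ∗ ν` lives on `[a + b, ∞)` (`conv_apply_Iio_eq_zero`), and if `ν` charges every
sub-interval of `[0, ∞)` while `a` is in the support of `μ` from the right, then `μ ∗ ν` charges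
every `(α, β)` with `a ≤ α < β` (`conv_apply_Ioo_pos`).

The second ingredient is the power `t^{-ν}` (`ν > 0`) as a Laplace transform,

  `t^{-ν} = ∫₀^∞ e^{-lt} l^{ν-1}/Γ(ν) dl`     (`t > 0`)

(`rpow_neg_eq_integral_exp_neg_mul`; Feller XIII.2, Example (b); this is Mathlib's Gamma
integral `Real.integral_rpow_mul_exp_neg_mul_Ioi` rearranged). The measure
`l^{ν-1}/Γ(ν) dl` on `(0, ∞)` is not finite, but after the "translation principle" (Feller,
loc. cit.) — weighting by `e^{-l t₀}`, `t₀ > 0` — it is: `t^{-ν} = ∫ e^{-l(t - t₀)} dγ(l)` for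
`t > t₀` with the FINITE measure `dγ = e^{-l t₀} l^{ν-1}/Γ(ν) dl` on `(0, ∞)`, which charges
every sub-interval of `[0, ∞)` (`exists_finiteMeasure_laplace_eq_rpow_neg`).

Combining the two (`exists_finiteMeasure_rpow_neg_mul_laplace`): for a finite measure `m`
carried by `[c, ∞)` (`c > 0`) charging every `(α, β)`, `c ≤ α < β`, and `ν, t₀ > 0`, the
function `t ↦ t^{-ν} ∫ e^{-lt} dm(l)` is, for `t > t₀`, the shifted Laplace transform
`∫ e^{-l(t-t₀)} dm'(l)` of the finite measure `m' = (e^{-l t₀} m) ∗ γ`, again carried by `[c, ∞)`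
and charging every `(α, β)`, `c ≤ α < β`. This is the repackaging used (with
`Literature/Analysis/Complex/LaplaceDecaySupportMeasure.lean`) to peel power prefactors
`t^{-ν}` off Laplace transforms of Bessel-type push-forward measures
(`Literature/Analysis/SpecialFunctions/BesselKLaplace.lean`).

## References

* D. V. Widder, *The Laplace Transform*, Princeton Mathematical Series 6, Princeton University
  Press (1941), Ch. II §11 ("Stieltjes resultant"), Theorem 11.5 (the product theorem for
  Laplace–Stieltjes transforms). [folklore]
* W. Feller, *An Introduction to Probability Theory and Its Applications*, Vol. II, 2nd ed.,
  Wiley (1971), XIII.2: (2.2) (multiplication rule `ω = φγ` for the convolution of measures on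
  `[0, ∞)`), Example (b) (`x^{α-1}/Γ(α) ↔ λ^{-α}`) and the translation principle. [folklore]

What is NOT here: Laplace transforms at complex arguments, signed/complex measures, and the
converse statements (uniqueness / Bernstein's theorem: Mathlib and
`Literature/Analysis/Complex/LaplaceDecaySupportMeasure.lean`).
-/

noncomputable section

open _root_.MeasureTheory _root_.Set _root_.Filter
open scoped ENNReal

namespace Literature.Analysis.Convolution

/-! ## The product theorem -/

/-- **Product theorem for Laplace transforms of measures** (Widder Ch. II Thm 11.5; Feller
XIII.2 (2.2)). For measures `μ, ν` on `ℝ` (`ν` s-finite) and real `t`,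
`∫ e^{-lt} d(μ ∗ ν)(l) = (∫ e^{-lt} dμ(l)) (∫ e^{-lt} dν(l))`, where `μ ∗ ν` is the additive
convolution `MeasureTheory.Measure.conv`. No finiteness, support or sign condition on `t` is
needed: the integrand is positive, so both sides are `toReal` of the corresponding lower
Lebesgue integrals (a non-integrable side is `0` on both sides by Mathlib's conventions), and
for those the identity is Tonelli (`MeasureTheory.Measure.lintegral_conv`) and
`e^{-(x+y)t} = e^{-xt} e^{-yt}`. [folklore] -/
theorem integral_exp_neg_mul_conv (μ ν : Measure ℝ) [SFinite ν] (t : ℝ) :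
    ∫ l, Real.exp (-(l * t)) ∂(μ ∗ ν) =
      (∫ l, Real.exp (-(l * t)) ∂μ) * (∫ l, Real.exp (-(l * t)) ∂ν) := by
  have hc : Continuous fun l : ℝ => Real.exp (-(l * t)) :=
    Real.continuous_exp.comp (continuous_id.mul continuous_const).neg
  have hm : Measurable fun l : ℝ => ENNReal.ofReal (Real.exp (-(l * t))) :=
    hc.measurable.ennreal_ofReal
  have hnn : ∀ ρ : Measure ℝ, 0 ≤ᵐ[ρ] fun l : ℝ => Real.exp (-(l * t)) :=
    fun ρ => ae_of_all _ fun l => (Real.exp_pos _).le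
  rw [integral_eq_lintegral_of_nonneg_ae (hnn _) hc.aestronglyMeasurable,
    integral_eq_lintegral_of_nonneg_ae (hnn _) hc.aestronglyMeasurable,
    integral_eq_lintegral_of_nonneg_ae (hnn _) hc.aestronglyMeasurable, ← ENNReal.toReal_mul,
    Measure.lintegral_conv hm]
  congr 1
  have hxy : ∀ x y : ℝ, ENNReal.ofReal (Real.exp (-((x + y) * t))) =
      ENNReal.ofReal (Real.exp (-(x * t))) * ENNReal.ofReal (Real.exp (-(y * t))) := by
    intro x y
    rw [← ENNReal.ofReal_mul (Real.exp_pos _).le, ← Real.exp_add]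
    congr 1
    ring
  simp_rw [hxy, lintegral_const_mul _ hm, lintegral_mul_const _ hm]

/-! ## Supports and charged intervals of a convolution -/

/-- **Lower supports add under convolution.** If `μ` gives no mass to `(-∞, a)` and `ν` gives
no mass to `(-∞, b)` (`ν` s-finite), then `μ ∗ ν` gives no mass to `(-∞, a + b)`: the preimage
of `(-∞, a + b)` under `(x, y) ↦ x + y` is contained in `((-∞, a) × ℝ) ∪ (ℝ × (-∞, b))`, a
`μ ⊗ ν`-null set. [folklore] -/
theorem conv_apply_Iio_eq_zero {μ ν : Measure ℝ} [SFinite ν] {a b : ℝ}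
    (hμ : μ (Set.Iio a) = 0) (hν : ν (Set.Iio b) = 0) : (μ ∗ ν) (Set.Iio (a + b)) = 0 := by
  rw [Measure.conv, Measure.map_apply measurable_add measurableSet_Iio]
  refine measure_mono_null (t := Iio a ×ˢ univ ∪ univ ×ˢ Iio b) ?_ ?_
  · intro p hp
    rw [mem_preimage, mem_Iio] at hp
    by_contra h
    simp only [mem_union, mem_prod, mem_Iio, mem_univ, and_true, true_and, not_or, not_lt] at h
    linarith [h.1, h.2]
  · rw [measure_union_null_iff, Measure.prod_prod, Measure.prod_prod, hμ, hν, zero_mul,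
      mul_zero]
    exact ⟨rfl, rfl⟩

/-- **Convolutions charge intervals.** Let `ν` (s-finite) charge every interval `(α', β')` with
`0 ≤ α' < β'`, and let `a` be in the support of `μ` "from the right" (`μ [a, a + ε) > 0` for
every `ε > 0`). Then `μ ∗ ν` charges every `(α, β)` with `a ≤ α < β`: with `ε = (β - α)/2`,
the box `[a, a + ε) × (α - a, β - a - ε)` is mapped into `(α, β)` by `(x, y) ↦ x + y` and has
positive `μ ⊗ ν`-measure. [folklore] -/
theorem conv_apply_Ioo_pos {μ ν : Measure ℝ} [SFinite ν] {a α β : ℝ}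
    (hν : ∀ α' β' : ℝ, 0 ≤ α' → α' < β' → 0 < ν (Set.Ioo α' β'))
    (hμ : ∀ ε > 0, 0 < μ (Set.Ico a (a + ε))) (haα : a ≤ α) (hαβ : α < β) :
    0 < (μ ∗ ν) (Set.Ioo α β) := by
  rw [Measure.conv, Measure.map_apply measurable_add measurableSet_Ioo]
  obtain ⟨ε, hε, hε0⟩ : ∃ ε : ℝ, ε = (β - α) / 2 ∧ 0 < ε := ⟨_, rfl, by linarith⟩
  have hsub : Ico a (a + ε) ×ˢ Ioo (α - a) (β - a - ε) ⊆
      (fun p : ℝ × ℝ => p.1 + p.2) ⁻¹' Ioo α β := by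
    intro p hp
    simp only [mem_prod, mem_Ico, mem_Ioo] at hp
    rw [mem_preimage, mem_Ioo]
    constructor <;> linarith [hp.1.1, hp.1.2, hp.2.1, hp.2.2]
  refine lt_of_lt_of_le ?_ (measure_mono hsub)
  rw [Measure.prod_prod]
  exact ENNReal.mul_pos (hμ ε hε0).ne' (hν _ _ (by linarith) (by rw [hε]; linarith)).ne'

/-! ## The power `t^{-ν}` as a Laplace transform -/

/-- **`t^{-ν}` is the Laplace transform of `l^{ν-1}/Γ(ν)` on `(0, ∞)`** (Feller XIII.2,
Example (b)): for `ν > 0` and `t > 0`, `t^{-ν} = ∫₀^∞ e^{-lt} · l^{ν-1}/Γ(ν) dl`. This is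
Mathlib's Gamma integral `Real.integral_rpow_mul_exp_neg_mul_Ioi`
(`∫₀^∞ l^{ν-1} e^{-tl} dl = (1/t)^ν Γ(ν)`) divided by `Γ(ν) > 0`. [folklore] -/
theorem rpow_neg_eq_integral_exp_neg_mul {ν t : ℝ} (hν : 0 < ν) (ht : 0 < t) :
    t ^ (-ν) = ∫ l in Set.Ioi (0:ℝ), Real.exp (-(l * t)) * (l ^ (ν - 1) / Real.Gamma ν) := by
  have hΓ : 0 < Real.Gamma ν := Real.Gamma_pos_of_pos hν
  have h2 : ∫ l in Set.Ioi (0:ℝ), Real.exp (-(l * t)) * (l ^ (ν - 1) / Real.Gamma ν) =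
      (∫ l in Set.Ioi (0:ℝ), l ^ (ν - 1) * Real.exp (-(t * l))) / Real.Gamma ν := by
    rw [← integral_div]
    refine setIntegral_congr_fun measurableSet_Ioi fun l _ => ?_
    rw [mul_comm t l]
    ring
  rw [h2, Real.integral_rpow_mul_exp_neg_mul_Ioi hν ht, one_div, Real.inv_rpow ht.le,
    Real.rpow_neg ht.le, mul_div_assoc, div_self hΓ.ne', mul_one]

/-- The density `l ↦ e^{-lt} l^{ν-1}/Γ(ν)` is integrable on `(0, ∞)` for `ν, t > 0` (the Gamma
integral converges). Proof: its integral is `t^{-ν} ≠ 0`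
(`rpow_neg_eq_integral_exp_neg_mul`), while a non-integrable function has integral `0`.
[folklore] -/
theorem integrableOn_exp_neg_mul_mul_rpow_div_Gamma {ν t : ℝ} (hν : 0 < ν) (ht : 0 < t) :
    IntegrableOn (fun l : ℝ => Real.exp (-(l * t)) * (l ^ (ν - 1) / Real.Gamma ν))
      (Set.Ioi 0) := by
  by_contra h
  have h1 := rpow_neg_eq_integral_exp_neg_mul hν ht
  rw [integral_undef h] at h1
  exact (Real.rpow_pos_of_pos ht _).ne' h1

/-- **`t^{-ν}` as a shifted Laplace transform of a FINITE measure** (Feller XIII.2, Example (b)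
and the translation principle). For `ν > 0` and `t₀ > 0` there is a finite measure `γ` on `ℝ`
— namely `dγ(l) = e^{-l t₀} l^{ν-1}/Γ(ν) dl` on `(0, ∞)` — carried by `[0, ∞)`, charging every
interval `(α, β)` with `0 ≤ α < β`, and with `∫ e^{-l(t - t₀)} dγ(l) = t^{-ν}` for every
`t > t₀`. [folklore] -/
theorem exists_finiteMeasure_laplace_eq_rpow_neg {ν t₀ : ℝ} (hν : 0 < ν) (ht₀ : 0 < t₀) :
    ∃ γ : MeasureTheory.Measure ℝ, MeasureTheory.IsFiniteMeasure γ ∧ γ (Set.Iio 0) = 0 ∧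
      (∀ α β : ℝ, 0 ≤ α → α < β → 0 < γ (Set.Ioo α β)) ∧
      ∀ t : ℝ, t₀ < t → ∫ l, Real.exp (-(l * (t - t₀))) ∂γ = t ^ (-ν) := by
  set g : ℝ → ℝ := fun l => Real.exp (-(l * t₀)) * (l ^ (ν - 1) / Real.Gamma ν) with hg
  have hgm : Measurable g :=
    (Real.continuous_exp.measurable.comp (measurable_id.mul_const _).neg).mul
      ((measurable_id.pow_const _).div_const _)
  have hgm' : Measurable fun l => ENNReal.ofReal (g l) := hgm.ennreal_ofReal
  have hgpos : ∀ l : ℝ, 0 < l → 0 < g l := fun l hl =>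
    mul_pos (Real.exp_pos _) (div_pos (Real.rpow_pos_of_pos hl _) (Real.Gamma_pos_of_pos hν))
  refine ⟨(volume.restrict (Ioi 0)).withDensity fun l => ENNReal.ofReal (g l),
    isFiniteMeasure_withDensity_ofReal (integrableOn_exp_neg_mul_mul_rpow_div_Gamma hν ht₀).2,
    ?_, ?_, ?_⟩
  · -- carried by `[0, ∞)`
    refine withDensity_absolutelyContinuous _ _ ?_
    rw [Measure.restrict_apply measurableSet_Iio]
    have h0 : Set.Iio (0:ℝ) ∩ Set.Ioi 0 = ∅ :=
      eq_empty_of_forall_notMem fun x hx => lt_irrefl (0:ℝ) (hx.2.trans hx.1)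
    rw [h0, measure_empty]
  · -- charges every `(α, β)`, `0 ≤ α < β`: the density is positive on `(0, ∞)`
    intro α β hα hβ
    rw [pos_iff_ne_zero, Ne, withDensity_apply_eq_zero' hgm'.aemeasurable,
      Measure.restrict_apply' measurableSet_Ioi]
    have hsub : Set.Ioo α β ⊆ ({x | ENNReal.ofReal (g x) ≠ 0} ∩ Set.Ioo α β) ∩ Set.Ioi 0 := by
      intro x hx
      have hx0 : 0 < x := hα.trans_lt hx.1
      refine ⟨⟨?_, hx⟩, hx0⟩
      rw [mem_setOf_eq, Ne, ENNReal.ofReal_eq_zero, not_le]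
      exact hgpos x hx0
    intro h0
    have h1 := measure_mono_null hsub h0
    rw [Real.volume_Ioo, ENNReal.ofReal_eq_zero] at h1
    linarith
  · -- the Laplace transform
    intro t ht
    rw [integral_withDensity_eq_integral_toReal_smul hgm'
        (ae_of_all _ fun _ => ENNReal.ofReal_lt_top),
      rpow_neg_eq_integral_exp_neg_mul hν (ht₀.trans ht)]
    refine setIntegral_congr_fun measurableSet_Ioi fun l hl => ?_
    rw [ENNReal.toReal_ofReal (hgpos l hl).le, smul_eq_mul, hg, mul_right_comm, ← Real.exp_add]
    congr 2
    ring

/-! ## The package: `t^{-ν} × (Laplace transform)` is a shifted Laplace transform -/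

/-- **Power prefactors are absorbed into the measure.** Let `m` be a finite measure on `ℝ`
carried by `[c, ∞)` (`c > 0`) and charging every interval `(α, β)` with `c ≤ α < β`, and let
`ν, t₀ > 0`. Then there is a finite measure `m'` on `ℝ`, again carried by `[c, ∞)` and charging
every `(α, β)` with `c ≤ α < β`, such that for all `t > t₀`

  `t^{-ν} ∫ e^{-lt} dm(l) = ∫ e^{-l(t - t₀)} dm'(l)`.

Construction: `m' = (e^{-l t₀} dm) ∗ γ` with `γ` from `exists_finiteMeasure_laplace_eq_rpow_neg`
(`e^{-l t₀} dm` is finite; `∫ e^{-l(t-t₀)} e^{-l t₀} dm = ∫ e^{-lt} dm`), the product theorem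
`integral_exp_neg_mul_conv`, and `conv_apply_Iio_eq_zero` / `conv_apply_Ioo_pos` for the
support and the charged intervals (Feller XIII.2 (2.2) and Example (b)). [folklore] -/
theorem exists_finiteMeasure_rpow_neg_mul_laplace {m : MeasureTheory.Measure ℝ}
    [MeasureTheory.IsFiniteMeasure m] {c ν t₀ : ℝ} (hc : 0 < c) (hν : 0 < ν) (ht₀ : 0 < t₀)
    (hm0 : m (Set.Iio c) = 0) (hm : ∀ α β : ℝ, c ≤ α → α < β → 0 < m (Set.Ioo α β)) :
    ∃ m' : MeasureTheory.Measure ℝ, MeasureTheory.IsFiniteMeasure m' ∧ m' (Set.Iio c) = 0 ∧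
      (∀ α β : ℝ, c ≤ α → α < β → 0 < m' (Set.Ioo α β)) ∧
      ∀ t : ℝ, t₀ < t → (t ^ (-ν) : ℝ) * ∫ l, Real.exp (-(l * t)) ∂m =
        ∫ l, Real.exp (-(l * (t - t₀))) ∂m' := by
  obtain ⟨γ, hγfin, hγ0, hγpos, hγlap⟩ := exists_finiteMeasure_laplace_eq_rpow_neg hν ht₀
  have hwm : Measurable fun l : ℝ => ENNReal.ofReal (Real.exp (-(l * t₀))) :=
    (Real.continuous_exp.measurable.comp (measurable_id.mul_const _).neg).ennreal_ofReal
  set μ' : Measure ℝ := m.withDensity fun l => ENNReal.ofReal (Real.exp (-(l * t₀))) with hμ'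
  -- `μ' = e^{-l t₀} dm` is finite: the density is `≤ 1` on `[c, ∞) ⊇ supp m`
  haveI : IsFiniteMeasure μ' := by
    refine isFiniteMeasure_withDensity_ofReal (HasFiniteIntegral.of_bounded (C := 1) ?_)
    filter_upwards [measure_eq_zero_iff_ae_notMem.1 hm0] with l hl
    rw [mem_Iio, not_lt] at hl
    rw [Real.norm_eq_abs, abs_of_pos (Real.exp_pos _), Real.exp_le_one_iff, neg_nonpos]
    exact mul_nonneg (hc.le.trans hl) ht₀.le
  have hμ'0 : μ' (Set.Iio c) = 0 := withDensity_absolutelyContinuous _ _ hm0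
  have hμ'pos : ∀ ε > 0, 0 < μ' (Set.Ico c (c + ε)) := by
    intro ε hε
    rw [pos_iff_ne_zero, Ne, hμ', withDensity_apply_eq_zero' hwm.aemeasurable]
    have hsupp : {x : ℝ | ENNReal.ofReal (Real.exp (-(x * t₀))) ≠ 0} = univ :=
      eq_univ_of_forall fun x => by
        rw [mem_setOf_eq, Ne, ENNReal.ofReal_eq_zero, not_le]
        exact Real.exp_pos _
    rw [hsupp, univ_inter]
    exact fun h0 => (hm c (c + ε) le_rfl (by linarith)).ne'
      (measure_mono_null Ioo_subset_Ico_self h0)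
  have hμ'lap : ∀ t : ℝ, ∫ l, Real.exp (-(l * (t - t₀))) ∂μ' = ∫ l, Real.exp (-(l * t)) ∂m := by
    intro t
    rw [hμ', integral_withDensity_eq_integral_toReal_smul hwm
      (ae_of_all _ fun _ => ENNReal.ofReal_lt_top)]
    refine integral_congr_ae (ae_of_all _ fun l => ?_)
    dsimp only
    rw [ENNReal.toReal_ofReal (Real.exp_pos _).le, smul_eq_mul, ← Real.exp_add]
    congr 1
    ring
  refine ⟨μ' ∗ γ, inferInstance, ?_, fun α β hα hβ => conv_apply_Ioo_pos hγpos hμ'pos hα hβ,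
    fun t ht => ?_⟩
  · simpa only [add_zero] using conv_apply_Iio_eq_zero hμ'0 hγ0
  · rw [integral_exp_neg_mul_conv, hμ'lap t, hγlap t ht, mul_comm]

end Literature.Analysis.Convolution
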